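import Literature.Geometry.Symplectic.SteinTwoHandles
import Literature.Geometry.Symplectic.TwoHandleIsotopy
import Literature.Geometry.Symplectic.AttachingFramingProofs
import HarnessLib

/-!
# Akbulut–Matveyev's defect-zero criterion from Eliashberg's theorem (the §3 argument replayed)

Topic `Literature/Geometry/Symplectic`.  Akbulut–Matveyev (1998), §3 derive "defect zero ⇒ the PC
structure extends over the 2-handles" (`AkbulutMatveyev1998_defectZero`, recorded as printed in
`SteinTwoHandles.lean`) from Eliashberg's theorem in two sentences: *"If `tb(K) ≥ f + 1` then by
`C⁰`-small smooth isotopy of `K` we can decrease Thurston–Bennequin invariant of `K` and make it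
equal to `f + 1`. Therefore, by a theorem of Eliashberg, manifold `Z ∪ h` possesses PC
structure."*  This file **proves** that derivation, for orientable `W`, from the named facts it
rests on:

* E2 `Gompf1998_thm13_twoHandles` (Eliashberg), ST `Gompf1998_addLeftTwists` (stabilisation),
  ISO `HandleAttachingMap.isMultiAttachment_of_linkIsotopyInBoundary` and TUBE
  `exists_handleAttachingMap_of_isKnotFraming` (`TwoHandleIsotopy.lean`), and
* TH `twisting_eq_of_framingHomotopic` (named fact, this file): the twisting number of a framing
  of a Legendrian knot only depends on its homotopy class through framings (Gompf 1998, §1: the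
  canonical framing, and framings compared with it, "up to fiber homotopy");

together with the theorem `isKnotFraming_attachingFraming` (`AttachingFramingProofs.lean`) and an
elementary separation lemma (pairwise disjoint compact sets in a Hausdorff space have pairwise
disjoint open neighbourhoods), which makes the `C⁰`-small isotopies of the different attaching
circles stay disjoint and lets TUBE produce attaching maps with disjoint ranges.

Main theorem: `AkbulutMatveyev1998_defectZero_of_facts` — under E2, ST, ISO, TUBE, TH, the
conclusion of `AkbulutMatveyev1998_defectZero` holds for every *orientable* `W` (AM's `Z` is a
complex, hence oriented, manifold; `SteinStructure` does not record an orientation, which is why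
the orientable case is what the facts give).

## References

* S. Akbulut, R. Matveyev, IMRN 1998, §3. [AkbulutMatveyev1998]
* R. E. Gompf, Ann. of Math. 148 (1998), §1, Thm. 1.3. [Gompf1998]
-/

noncomputable section

open scoped Manifold ContDiff Topology
open Set Function

namespace Literature.Geometry.Symplectic

open Literature.Topology.FourManifolds

/-- The model vector space `ℝ⁴` of the tangent spaces. [folklore] -/
local notation "E4" => EuclideanSpace ℝ (Fin 4)

/-- Local notation: `𝕊 n` is the unit sphere in `EuclideanSpace ℝ (Fin (n + 1))`. -/
local notation "𝕊 " n:arg => (Metric.sphere (0 : EuclideanSpace ℝ (Fin (n + 1))) 1)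

/-! ### The remaining named fact: twisting is a homotopy invariant of framings -/

/-- **The twisting number only depends on the homotopy class of the framing** (Gompf 1998, §1:
framings of a Legendrian knot are compared with the canonical framing "up to fiber homotopy";
the twisting number `f - tb` is the class of the framing in `π₁(SO(2)) = ℤ` relative to the
canonical one).  For a Legendrian knot `K` in the boundary of a compact Stein `W` and framings
`ν`, `ν'` homotopic through framings (`FramingHomotopic`), `twisting K ν = twisting K ν'`.  (A
proof in the tree needs the bundle-level continuity of `ω(ċ, ·)`, `α` along `K`, not yet
available; see `SteinBoundaryContact.lean`.) [cite: Gompf1998, §1] -/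
def twisting_eq_of_framingHomotopic : Prop :=
  ∀ (W : Type) [TopologicalSpace W] [T2Space W] [ChartedSpace (EuclideanHalfSpace 4) W]
    [IsManifold (𝓡∂ 4) ∞ W] [CompactSpace W] (S : SteinStructure W) (K : 𝕊 1 → W)
    (ν ν' : 𝕊 1 → E4), IsLegendrianKnot S.J K → FramingHomotopic K ν ν' →
    S.twisting K ν = S.twisting K ν'

/-! ### Separation of finitely many disjoint compact sets -/

/-- **Pairwise disjoint compact sets in a Hausdorff space have pairwise disjoint open
neighbourhoods** (finitely many). [folklore] -/
theorem exists_pairwise_disjoint_open_of_isCompact {X : Type*} [TopologicalSpace X] [T2Space X]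
    {ι : Type*} [Finite ι] (C : ι → Set X) (hC : ∀ i, IsCompact (C i))
    (hd : Pairwise fun i j => Disjoint (C i) (C j)) :
    ∃ U : ι → Set X, (∀ i, IsOpen (U i)) ∧ (∀ i, C i ⊆ U i) ∧
      Pairwise fun i j => Disjoint (U i) (U j) := by
  classical
  -- separating neighbourhoods for each ordered pair
  have sep : ∀ p : {p : ι × ι // p.1 ≠ p.2}, ∃ AB : Set X × Set X,
      IsOpen AB.1 ∧ IsOpen AB.2 ∧ C p.1.1 ⊆ AB.1 ∧ C p.1.2 ⊆ AB.2 ∧ Disjoint AB.1 AB.2 := by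
    intro p
    obtain ⟨A, B, hA, hB, hCA, hCB, hAB⟩ :=
      SeparatedNhds.of_isCompact_isCompact (hC p.1.1) (hC p.1.2) (hd p.2)
    exact ⟨(A, B), hA, hB, hCA, hCB, hAB⟩
  choose AB hAB using sep
  refine ⟨fun i => (⋂ j : {j : ι // i ≠ j}, (AB ⟨(i, j.1), j.2⟩).1) ∩
      ⋂ j : {j : ι // j ≠ i}, (AB ⟨(j.1, i), j.2⟩).2, ?_, ?_, ?_⟩
  · intro i
    exact (isOpen_iInter_of_finite fun j => (hAB _).1).inter
      (isOpen_iInter_of_finite fun j => (hAB _).2.1)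
  · intro i
    exact subset_inter (subset_iInter fun j => (hAB ⟨(i, j.1), j.2⟩).2.2.1)
      (subset_iInter fun j => (hAB ⟨(j.1, i), j.2⟩).2.2.2.1)
  · intro i j hij
    refine Set.disjoint_left.2 fun x hxi hxj => ?_
    have h1 : x ∈ (AB ⟨(i, j), hij⟩).1 := (mem_iInter.1 hxi.1) ⟨j, hij⟩
    have h2 : x ∈ (AB ⟨(i, j), hij⟩).2 := (mem_iInter.1 hxj.2) ⟨i, hij⟩
    exact Set.disjoint_left.1 (hAB ⟨(i, j), hij⟩).2.2.2.2 h1 h2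

/-! ### The derivation -/

/-- **Akbulut–Matveyev's defect-zero criterion, derived from Eliashberg's theorem** (AM 1998, §3,
the two-sentence argument, replayed for orientable `W`): under the named facts E2, ST, ISO, TUBE
and TH, if `P` is a compact Stein `W` with 2-handles attached along attaching maps `h i` whose
attaching circles are Legendrian and whose handle framings have defect `0`, then `P` admits a
Stein structure.  Proof: stabilise each attaching circle by a `C⁰`-small isotopy inside pairwise
disjoint neighbourhoods (ST, defect `0` ⇒ twisting of the carried framing becomes `-1`;
`isKnotFraming_attachingFraming` supplies the framing hypothesis), realise the stabilised framed
knots by attaching maps with disjoint ranges (TUBE), transport the attachment (ISO), compare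
twisting numbers (TH) and apply E2. [cite: AkbulutMatveyev1998, §3] -/
theorem AkbulutMatveyev1998_defectZero_of_facts (hE : Gompf1998_thm13_twoHandles)
    (hST : Gompf1998_addLeftTwists) (hISO : HandleAttachingMap.isMultiAttachment_of_linkIsotopyInBoundary)
    (hT : exists_handleAttachingMap_of_isKnotFraming) (hTH : twisting_eq_of_framingHomotopic)
    (W P : Type) [TopologicalSpace W] [T2Space W] [ChartedSpace (EuclideanHalfSpace 4) W]
    [IsManifold (𝓡∂ 4) ∞ W] [CompactSpace W] [TopologicalSpace P]
    [ChartedSpace (EuclideanHalfSpace 4) P] [IsManifold (𝓡∂ 4) ∞ P] [CompactSpace P]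
    (ho : IsOrientable (𝓡∂ 4) W) (S : SteinStructure W) (ι : Type) [Finite ι]
    (h : ι → HandleAttachingMap 3 2 W) (hP : HandleAttachingMap.IsMultiAttachment h (𝓡∂ 4) P)
    (hLeg : ∀ i, IsLegendrianKnot S.J (h i).attachingCircle)
    (hd : ∀ i, S.defect (h i).attachingCircle (h i).attachingFraming = 0) : IsSteinDomain P := by
  -- disjoint open neighbourhoods of the attaching circles
  have hcpt : ∀ i, IsCompact (range (h i).attachingCircle) := fun i =>
    isCompact_range (h i).continuous_attachingCircle
  have hdis : Pairwise fun i j => Disjoint (range (h i).attachingCircle) (range (h j).attachingCircle) :=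
    (isBoundaryLink_attachingCircle (P := P) S hP hLeg).disjoint
  obtain ⟨U, hUo, hKU, hUd⟩ := exists_pairwise_disjoint_open_of_isCompact _ hcpt hdis
  -- stabilise each attaching circle inside `U i`
  have hstab : ∀ i, ∃ (K' : 𝕊 1 → W) (Φ : KnotIsotopyInBoundary (h i).attachingCircle K')
      (νt : ℝ → 𝕊 1 → E4), IsLegendrianKnot S.J K' ∧ Φ.IsSmall {q : (𝕊 1) × W | q.2 ∈ U i} ∧
        IsFramingAlong Φ (h i).attachingFraming νt ∧ S.twisting K' (νt 1) = -1 := fun i =>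
    hST.exists_twisting_eq_neg_one S (hLeg i) (isKnotFraming_attachingFraming (h i)) (hd i)
      ((hUo i).preimage continuous_snd) fun u => hKU i (mem_range_self u)
  choose K' Φ νt hK'Leg hsmall hfr htw using hstab
  -- the stabilised circles form a link isotopic to the attaching circles
  have hstage : ∀ i, ∀ t ∈ Icc (0 : ℝ) 1, ∀ u, (Φ i).toFun t u ∈ U i := fun i t ht u =>
    hsmall i t ht u
  have hK'U : ∀ i, range (K' i) ⊆ U i := fun i => by
    rintro _ ⟨u, rfl⟩
    have := hstage i 1 ⟨zero_le_one, le_rfl⟩ u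
    rwa [(Φ i).map_one] at this
  let Ψ : LinkIsotopyInBoundary (fun i => (h i).attachingCircle) K' :=
    ⟨Φ, fun t ht i j hij => Set.disjoint_left.2 fun x ⟨u, hu⟩ ⟨u', hu'⟩ =>
      Set.disjoint_left.1 (hUd hij) (hu ▸ hstage i t ht u) (hu' ▸ hstage j t ht u')⟩
  -- realise the stabilised framed knots by attaching maps with ranges in `U i`
  have htube : ∀ i, ∃ h' : HandleAttachingMap 3 2 W, range h'.toFun ⊆ U i ∧
      h'.attachingCircle = K' i ∧ FramingHomotopic (K' i) (νt i 1) h'.attachingFraming := fun i =>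
    hT W ho (K' i) (νt i 1) (hK'Leg i).isBoundaryKnot (hfr i).isKnotFraming_one (U i) (hUo i) (hK'U i)
  choose h' hrange hcirc hhom using htube
  have hdis' : Pairwise fun i j => Disjoint (range (h' i).toFun) (range (h' j).toFun) :=
    fun i j hij => Set.disjoint_of_subset (hrange i) (hrange j) (hUd hij)
  -- identify the stabilised circles with the attaching circles of the new attaching maps
  have hK'eq : (fun i => (h' i).attachingCircle) = K' := funext hcirc
  subst hK'eq
  -- transport the attachment along the isotopy
  have hP' : HandleAttachingMap.IsMultiAttachment h' (𝓡∂ 4) P :=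
    hISO W P ι h h' Ψ νt (fun i => hfr i) (fun i => hhom i) hdis' hP
  -- the new handle framings have twisting `-1`; apply Eliashberg's theorem
  refine hE W P S ι h' hP' (fun i => hK'Leg i) fun i => ?_
  rw [← hTH W S _ (νt i 1) (h' i).attachingFraming (hK'Leg i) (hhom i)]
  exact htw i

end Literature.Geometry.Symplectic

end
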